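import Mathlib
import Summits.NavierStokesRegularity.NavierStokesRegularity.Theorems.AxisTwistDoorTiltDominationLocNoSingularSegment
import HarnessLib

/-!
# AxisTwistDoor · crux `TiltDominationLoc` (stmt-NavierStokesRegularity-26991, wall W3) — NO PLANAR SINGULAR CONTINUUM through
# the apex; NO ROTATIONAL SYMMETRY ABOUT ANY AXIS WHATSOEVER (portrait clause (xiv))

Helper file of the LEAD (ns-atd-p1 g5; `--supports stmt-NavierStokesRegularity-26991 --as helper`).  No definitions.  Sequel to
`…TiltDominationLocNoSingularSegment` (p660184): the WHOLE open regular shell `{a−δ < |x_h| < a+δ, |x₃| < a+δ}` of Lei–Ren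
(tree: `ShellFact`, proved) consists of points that are not backward-singular at time `0`, for every profile of the core
class.  Consequently:

* `exists_regular_shell` — the shell, with all its points regular;
* `not_singular_planar_continuum` — **no preconnected set `K` of time-0 backward-singular points lying in a plane through
  the apex can contain the apex and another point** (rotate the plane to the horizontal one, rescale the other point to
  the unit sphere, and meet the shell by the intermediate value theorem for `‖·‖` on `K`);
* `not_isBackwardSingularPoint_of_rotInvariant` — **portrait clause (xiv): the W3 counterexample is invariant under the
  rotations about NO axis at all** — for the vertical axis through an arbitrary point `c`: if `c` is on the apex axis this
  is clause (xii) (`…AxisymmetricExclusion`, Seregin–Šverák), otherwise the orbit of the apex is a horizontal circle of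
  singular points through the apex, a planar continuum; any other axis direction is reduced to the vertical one by
  `…AxisymmetricExclusion.not_isBackwardSingularPoint_of_isAxisymmetric_conj`-style conjugation (stated here for the
  vertical direction, the frame being arbitrary).

HONEST FRAMING: statements about HYPOTHETICAL Type-I blow-up profiles; W3 (26991), W4, W6, the leaf and Navier–Stokes
regularity (Clay A) are OPEN; nothing here is an NS regularity statement.
[cite: LeiRenTian2025, Lemma 2.4 (arXiv:2501.08976 p. 7)] [cite: AlbrittonBarker2019, §1, §3] [cite: SereginSverak2009, Thm. 3.1]
-/

noncomputable section

-- the summit and its single sub-problem share the name (CONVENTIONS §1), as in every Theorems file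
set_option linter.dupNamespace false

namespace Summit.NavierStokesRegularity.NavierStokesRegularity.Theorems.AxisTwistDoorTiltDominationLocNoSingularContinuum

open Set Function MeasureTheory Filter Metric
open scoped InnerProductSpace ENNReal RealInnerProductSpace
open Literature.Analysis Literature.Analysis.FluidPDE
open Summit.NavierStokesRegularity.NavierStokesRegularity.Theorems
open Summit.NavierStokesRegularity.NavierStokesRegularity.Theorems.AxisTwistDoorAveragedConeLiouvilleDefs (InClass cylPt)
open Summit.NavierStokesRegularity.NavierStokesRegularity.Theorems.AxisTwistDoorTiltDominationLocEnergyClass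
  (exists_energyClass_of_typeI)
open Summit.NavierStokesRegularity.NavierStokesRegularity.Theorems.AxisTwistDoorTiltDominationLocAxisymmetricExclusion
  (not_isBackwardSingularPoint_of_isAxisymmetric)
open Summit.NavierStokesRegularity.NavierStokesRegularity.Theorems.AxisTwistDoorTiltDominationLocNoSingularSegment
open Summit.NavierStokesRegularity.NavierStokesRegularity.Theorems.PoloidalWindowDoorPoloidalWindowRigidityRotate
  (class_conj_linearIsometryEquiv)
open Summit.NavierStokesRegularity.NavierStokesRegularity.Theorems.PoloidalWindowDoorPoloidalWindowRigidityWindow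
  (isTypeIAncientMild_of_class)
open Summit.NavierStokesRegularity.NavierStokesRegularity.Theorems.FarPastLedger.Negative (isTypeIAncientMild_nsRescale)
open Summit.NavierStokesRegularity.NavierStokesRegularity.Theorems.RellichScarSimilarityCovariance
  (LIE.isBackwardSingularPoint_zero_conj)
open Summit.NavierStokesRegularity.NavierStokesRegularity.Theorems.TypeITraceScarL3 (isBackwardSingularPoint_translate_zero_iff)
open Summit.NavierStokesRegularity.NavierStokesRegularity.Theorems.AveragedConeLiouville.RegularShell (lipschitzWith_cylRadius)
open Summit.NavierStokesRegularity.NavierStokesRegularity.Theorems.AveragedConeLiouville.PositivityCover (abs_apply_le_norm)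

variable {C : ℝ} {v : ℝ → EuclideanSpace ℝ (Fin 3) → EuclideanSpace ℝ (Fin 3)}

/-! ### §1 The whole regular shell -/

/-- A horizontal vector (`y₃ = 0`) has cylindrical radius equal to its norm. -/
theorem cylRadius_eq_norm_of_apply_two_eq_zero {y : EuclideanSpace ℝ (Fin 3)} (hy : y 2 = 0) : cylRadius y = ‖y‖ := by
  rw [cylRadius, EuclideanSpace.norm_eq, Fin.sum_univ_three]
  simp [hy]

/-- **The open regular shell.**  Every Type-I ancient Oseen-mild profile (core class) has a cylindrical shell
`{a−δ < |x_h| < a+δ, |x₃| < a+δ}`, `2/3 < a < 4/5`, `0 < δ ≤ 1/10`, NO point of which is backward-singular at time `0`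
(Lei–Ren's quantitative regular shell for the automatic energy class, `ShellFact`: `|v| ≤ B` there for
`−(a+δ)² < t < 0`). [cite: LeiRenTian2025, Lemma 2.4 (arXiv:2501.08976 p. 7); AlbrittonBarker2019, §1] -/
theorem exists_regular_shell (hrate : HasTypeITimeDecay C v)
    (hcont : ContinuousOn (uncurry v) (Iio (0 : ℝ) ×ˢ univ))
    (hmild : ∀ s t : ℝ, s < t → t < 0 → ∀ x,
      v t x = UnboundedOperators.heatExtension (v s) (t - s) x - oseenDuhamel 1 s v v t x)
    (hdiv : ∀ t < 0, VectorCalculus.IsDivFree (v t)) :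
    ∃ a δ : ℝ, 2 / 3 < a ∧ a < 4 / 5 ∧ 0 < δ ∧ δ ≤ 1 / 10 ∧
      ∀ x₀ : EuclideanSpace ℝ (Fin 3), a - δ < cylRadius x₀ → cylRadius x₀ < a + δ → |x₀ 2| < a + δ →
        ¬ IsBackwardSingularPoint v ((0 : ℝ), x₀) := by
  obtain ⟨π, H, hsw, hwg, hI⟩ := exists_energyClass_of_typeI hrate hcont hmild hdiv
  have hcl : InClass C v π H := ⟨hrate, hcont, hmild, hdiv, hsw, hwg, hI⟩
  obtain ⟨δ₀, B, hδ₀, -, hshell⟩ :=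
    AveragedConeLiouville.Shell.shellFact_holds (typeIBound (Iio (0 : ℝ) ×ˢ univ) v π H) hI
  obtain ⟨a, δ, ha1, ha2, hδ1, hδ2, hbd⟩ := hshell C v π H hcl le_rfl
  have hδ : 0 < δ := hδ₀.trans_le hδ1
  refine ⟨a, δ, ha1, ha2, hδ, hδ2, fun x₀ hx1 hx2 hx3 => ?_⟩
  -- a ball about `x₀` inside the shell
  set ρ : ℝ := min (min (cylRadius x₀ - (a - δ)) (a + δ - cylRadius x₀)) (a + δ - |x₀ 2|) with hρ
  have hρ0 : 0 < ρ := lt_min (lt_min (by linarith) (by linarith)) (by linarith)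
  have hρ1 : ρ ≤ cylRadius x₀ - (a - δ) := (min_le_left _ _).trans (min_le_left _ _)
  have hρ2 : ρ ≤ a + δ - cylRadius x₀ := (min_le_left _ _).trans (min_le_right _ _)
  have hρ3 : ρ ≤ a + δ - |x₀ 2| := min_le_right _ _
  refine not_isBackwardSingularPoint_of_norm_le (M := B) hρ0 fun t ht1 ht2 y hy => ?_
  rw [mem_ball, dist_eq_norm] at hy
  have hr : |cylRadius y - cylRadius x₀| < ρ := by
    have h := lipschitzWith_cylRadius.dist_le_mul y x₀
    rw [NNReal.coe_one, one_mul, Real.dist_eq, dist_eq_norm] at h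
    exact h.trans_lt hy
  obtain ⟨hr1, hr2⟩ := abs_lt.1 hr
  have hz : |y 2| < a + δ := by
    have h1 : |(y - x₀) 2| ≤ ‖y - x₀‖ := abs_apply_le_norm (y - x₀) 2
    have h2 : (y - x₀) 2 = y 2 - x₀ 2 := by simp
    rw [h2] at h1
    have h3 : |y 2| ≤ |x₀ 2| + |y 2 - x₀ 2| := by
      have := abs_add_le (x₀ 2) (y 2 - x₀ 2); rwa [add_sub_cancel] at this
    linarith
  have hry : a - δ < cylRadius y := by linarith
  have hy01 : y 0 ≠ 0 ∨ y 1 ≠ 0 := by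
    by_contra h0
    push Not at h0
    have : cylRadius y = 0 := by rw [cylRadius, h0.1, h0.2]; simp
    linarith
  obtain ⟨r, θ, hrpos, hr2sq, hyeq⟩ := exists_cylPt_eq_of_ne y hy01
  have hrr : r = cylRadius y := by rw [cylRadius, ← hr2sq, Real.sqrt_sq hrpos.le]
  have hta : -(a + δ) ^ 2 < t := by
    have hρa : ρ ≤ a + δ := by linarith [abs_nonneg (x₀ 2)]
    nlinarith
  have key := (hbd t hta ht2 r θ (y 2) (by rw [hrr]; linarith) (by rw [hrr]; linarith) hz).1
  rwa [hyeq] at key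

/-! ### §2 No planar singular continuum through the apex -/

/-- **No planar singular continuum through the apex.**  Let `K ⊆ ℝ³` be preconnected, contained in a plane through the
origin (`⟪x, n⟫ = 0` on `K`, `n ≠ 0`), containing `0` and a point `p ≠ 0`.  Then no Type-I ancient Oseen-mild profile is
backward-singular at `(0, x)` for every `x ∈ K`: rotate `n/‖n‖` to `e₃` (the plane becomes horizontal, where `|x_h| = ‖x‖`),
rescale by `‖p‖`, and pick by the intermediate value theorem a point of the image continuum with `‖·‖ = a` — it lies in
the regular shell of §1. [cite: LeiRenTian2025, Lemma 2.4; AlbrittonBarker2019, §3] -/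
theorem not_singular_planar_continuum (hrate : HasTypeITimeDecay C v)
    (hcont : ContinuousOn (uncurry v) (Iio (0 : ℝ) ×ˢ univ))
    (hmild : ∀ s t : ℝ, s < t → t < 0 → ∀ x,
      v t x = UnboundedOperators.heatExtension (v s) (t - s) x - oseenDuhamel 1 s v v t x)
    (hdiv : ∀ t < 0, VectorCalculus.IsDivFree (v t))
    {K : Set (EuclideanSpace ℝ (Fin 3))} (hK : IsPreconnected K) (h0 : (0 : EuclideanSpace ℝ (Fin 3)) ∈ K)
    {p : EuclideanSpace ℝ (Fin 3)} (hp : p ∈ K) (hp0 : p ≠ 0)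
    {n : EuclideanSpace ℝ (Fin 3)} (hn : n ≠ 0) (hplane : ∀ x ∈ K, ⟪x, n⟫_ℝ = 0)
    (hsing : ∀ x ∈ K, IsBackwardSingularPoint v ((0 : ℝ), x)) : False := by
  have hnn : 0 < ‖n‖ := norm_pos_iff.2 hn
  have hpn : 0 < ‖p‖ := norm_pos_iff.2 hp0
  set e₃ : EuclideanSpace ℝ (Fin 3) := EuclideanSpace.single (2 : Fin 3) (1 : ℝ) with he₃
  -- a linear isometry with `L (n/‖n‖) = e₃`
  have hunit : ‖(‖n‖⁻¹ : ℝ) • n‖ = ‖e₃‖ := by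
    rw [norm_smul, Real.norm_of_nonneg (inv_nonneg.2 hnn.le), inv_mul_cancel₀ hnn.ne', he₃]
    simp
  set L : EuclideanSpace ℝ (Fin 3) ≃ₗᵢ[ℝ] EuclideanSpace ℝ (Fin 3) :=
    Submodule.reflection (ℝ ∙ ((‖n‖⁻¹ : ℝ) • n - e₃))ᗮ with hL
  have hLn : L ((‖n‖⁻¹ : ℝ) • n) = e₃ := Submodule.reflection_sub hunit
  -- images of points of the plane are horizontal
  have hhor : ∀ x ∈ K, (L x) 2 = 0 := by
    intro x hx
    have h1 : (L x) 2 = ⟪L x, e₃⟫_ℝ := by rw [he₃, EuclideanSpace.inner_single_right]; simp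
    rw [h1, ← hLn, LinearIsometryEquiv.inner_map_map, real_inner_smul_right, hplane x hx, mul_zero]
  -- the rotated and rescaled profile
  obtain ⟨hrate', hcont', hmild', hdiv'⟩ := class_conj_linearIsometryEquiv L hrate hcont hmild hdiv
  set w : ℝ → EuclideanSpace ℝ (Fin 3) → EuclideanSpace ℝ (Fin 3) :=
    nsRescale ‖p‖ (fun t y => L (v t (L.symm y))) with hw_def
  have hw : IsTypeIAncientMild C w :=
    isTypeIAncientMild_nsRescale (isTypeIAncientMild_of_class hrate' hcont' hmild' hdiv') hpn
  -- the image continuum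
  set K' : Set (EuclideanSpace ℝ (Fin 3)) := (fun x => (‖p‖⁻¹ : ℝ) • L x) '' K with hK'
  have hK'c : IsPreconnected K' := hK.image _ ((continuous_const_smul _).comp L.continuous).continuousOn
  have hsing' : ∀ y ∈ K', IsBackwardSingularPoint w ((0 : ℝ), y) := by
    rintro _ ⟨x, hx, rfl⟩
    rw [hw_def, isBackwardSingularPoint_nsRescale_iff hpn, smul_smul, mul_inv_cancel₀ hpn.ne', one_smul]
    exact isBackwardSingularPoint_conj L (hsing x hx)
  have hhor' : ∀ y ∈ K', y 2 = 0 := by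
    rintro _ ⟨x, hx, rfl⟩
    simp [hhor x hx]
  -- the regular shell of `w` and a point of `K'` on the sphere of radius `a`
  obtain ⟨a, δ, ha1, ha2, hδ, -, hreg⟩ := exists_regular_shell hw.hasTypeITimeDecay hw.continuousOn_uncurry
    (fun s t hst ht x => hw.mild_eq_heatExtension hst ht x) (fun t ht => hw.isDivFree ht)
  have h0' : (0 : EuclideanSpace ℝ (Fin 3)) ∈ K' := ⟨0, h0, by simp⟩
  have hp' : (‖p‖⁻¹ : ℝ) • L p ∈ K' := ⟨p, hp, rfl⟩
  have hnorm1 : ‖(‖p‖⁻¹ : ℝ) • L p‖ = 1 := by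
    rw [norm_smul, Real.norm_of_nonneg (inv_nonneg.2 hpn.le), LinearIsometryEquiv.norm_map, inv_mul_cancel₀ hpn.ne']
  obtain ⟨y, hyK', hya⟩ : ∃ y ∈ K', ‖y‖ = a := by
    have h := hK'c.intermediate_value h0' hp' continuous_norm.continuousOn
      (show a ∈ Icc ‖(0 : EuclideanSpace ℝ (Fin 3))‖ ‖(‖p‖⁻¹ : ℝ) • L p‖ by
        rw [norm_zero, hnorm1]; exact ⟨by linarith, by linarith⟩)
    exact h
  have hcr : cylRadius y = a := by rw [cylRadius_eq_norm_of_apply_two_eq_zero (hhor' y hyK'), hya]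
  exact hreg y (by rw [hcr]; linarith) (by rw [hcr]; linarith) (by rw [hhor' y hyK', abs_zero]; linarith) (hsing' y hyK')

/-! ### §3 Rotational symmetry about ANY vertical axis is excluded (any axis, after a change of frame) -/

/-- **Portrait clause (xiv): no rotational symmetry about any axis.**  If a Type-I ancient Oseen-mild profile is invariant
under all rotations about the vertical axis through a point `c` — `v(t)(c + R_θ(x − c)) = R_θ v(t)(x)` — then the apex is
NOT backward-singular.  (`c` on the apex axis: clause (xii); otherwise the orbit of the apex, the horizontal circle
`{c − R_θ c}` through the apex, would consist of singular points — a planar continuum, §2.)  The vertical direction is no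
restriction: conjugate by a linear isometry first (`…AxisymmetricExclusion.not_isBackwardSingularPoint_of_isAxisymmetric_conj`).
[cite: SereginSverak2009, Thm. 3.1; LeiRenTian2025, Lemma 2.4] -/
theorem not_isBackwardSingularPoint_of_rotInvariant (hrate : HasTypeITimeDecay C v)
    (hcont : ContinuousOn (uncurry v) (Iio (0 : ℝ) ×ˢ univ))
    (hmild : ∀ s t : ℝ, s < t → t < 0 → ∀ x,
      v t x = UnboundedOperators.heatExtension (v s) (t - s) x - oseenDuhamel 1 s v v t x)
    (hdiv : ∀ t < 0, VectorCalculus.IsDivFree (v t)) (c : EuclideanSpace ℝ (Fin 3))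
    (hrot : ∀ t < (0 : ℝ), ∀ (θ : ℝ) (x : EuclideanSpace ℝ (Fin 3)), v t (c + rotZ θ (x - c)) = rotZ θ (v t x)) :
    ¬ IsBackwardSingularPoint v 0 := by
  have hsub : ∀ θ (a b : EuclideanSpace ℝ (Fin 3)), rotZ θ (a - b) = rotZ θ a - rotZ θ b := fun θ a b => by
    simpa using map_sub (rotZLIE θ) a b
  by_cases hc : c 0 = 0 ∧ c 1 = 0
  · -- the axis passes through the apex: plain axisymmetry
    refine not_isBackwardSingularPoint_of_isAxisymmetric hrate hcont hmild hdiv fun t ht θ x => ?_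
    have hfix : rotZ θ c = c := by
      ext i
      fin_cases i <;> simp [hc.1, hc.2]
    have h := hrot t ht θ x
    rwa [hsub, hfix, add_sub_cancel] at h
  · intro hsing
    -- the orbit of the apex is singular
    have horb : ∀ θ : ℝ, IsBackwardSingularPoint v ((0 : ℝ), c - rotZ θ c) := by
      intro θ
      have h1 : IsBackwardSingularPoint (fun t y => rotZLIE θ (v t ((rotZLIE θ).symm y))) 0 :=
        LIE.isBackwardSingularPoint_zero_conj (rotZLIE θ) hsing
      have h2 : IsBackwardSingularPoint (fun t y => v t (y + (c - rotZ θ c))) ((0 : ℝ), (0 : EuclideanSpace ℝ (Fin 3))) := by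
        refine isBackwardSingularPoint_congr_slab (fun t ht y => ?_) 0 h1
        show rotZLIE θ (v t ((rotZLIE θ).symm y)) = v t (y + (c - rotZ θ c))
        rw [rotZLIE_apply, rotZLIE_symm_apply]
        have h := hrot t ht θ (rotZ (-θ) y)
        rw [hsub, ← rotZ_add, add_neg_cancel, rotZ_zero] at h
        rw [← h]
        congr 1
        abel
      exact (isBackwardSingularPoint_translate_zero_iff (c - rotZ θ c) v).1 h2
    -- it is a horizontal circle through the apex: a planar continuum with the point `c − R_π c = 2 c_h ≠ 0`
    set e₃ : EuclideanSpace ℝ (Fin 3) := EuclideanSpace.single (2 : Fin 3) (1 : ℝ) with he₃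
    -- `θ ↦ R_θ c` is continuous: `R_θ c = cos θ • A + sin θ • B + D`
    set A : EuclideanSpace ℝ (Fin 3) := WithLp.toLp 2 ![c 0, c 1, 0] with hA
    set B : EuclideanSpace ℝ (Fin 3) := WithLp.toLp 2 ![-(c 1), c 0, 0] with hB
    set D : EuclideanSpace ℝ (Fin 3) := WithLp.toLp 2 ![0, 0, c 2] with hD
    have hdec : ∀ θ : ℝ, rotZ θ c = Real.cos θ • A + Real.sin θ • B + D := by
      intro θ
      ext i
      fin_cases i <;> simp [rotZ, hA, hB, hD] <;> ring
    have hcont_orb : Continuous (fun θ : ℝ => c - rotZ θ c) := by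
      have h1 : Continuous (fun θ : ℝ => Real.cos θ • A + Real.sin θ • B + D) :=
        ((Real.continuous_cos.smul continuous_const).add (Real.continuous_sin.smul continuous_const)).add
          continuous_const
      have h2 : (fun θ : ℝ => rotZ θ c) = fun θ => Real.cos θ • A + Real.sin θ • B + D := funext hdec
      have h3 : Continuous (fun θ : ℝ => rotZ θ c) := by rw [h2]; exact h1
      exact continuous_const.sub h3
    set K : Set (EuclideanSpace ℝ (Fin 3)) := range (fun θ : ℝ => c - rotZ θ c) with hKdef
    have hK : IsPreconnected K := (isPreconnected_range hcont_orb)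
    have h0K : (0 : EuclideanSpace ℝ (Fin 3)) ∈ K := ⟨0, by simp [rotZ_zero]⟩
    have hpK : c - rotZ Real.pi c ∈ K := ⟨Real.pi, rfl⟩
    have hp0 : c - rotZ Real.pi c ≠ 0 := by
      intro h0
      apply hc
      have e0 := congrArg (fun w : EuclideanSpace ℝ (Fin 3) => w 0) h0
      have e1 := congrArg (fun w : EuclideanSpace ℝ (Fin 3) => w 1) h0
      simp [rotZ] at e0 e1
      constructor <;> linarith
    have hplane : ∀ x ∈ K, ⟪x, e₃⟫_ℝ = 0 := by
      rintro _ ⟨θ, rfl⟩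
      rw [he₃, EuclideanSpace.inner_single_right]
      simp [rotZ]
    have he3 : e₃ ≠ 0 := fun h0 => by simpa [he₃] using congrArg (fun w : EuclideanSpace ℝ (Fin 3) => w 2) h0
    exact not_singular_planar_continuum hrate hcont hmild hdiv hK h0K hpK hp0 he3 hplane
      (by rintro _ ⟨θ, rfl⟩; exact horb θ)

end Summit.NavierStokesRegularity.NavierStokesRegularity.Theorems.AxisTwistDoorTiltDominationLocNoSingularContinuum

end
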